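import Summits.QuantumFields.YangMills.Theorems.BalabanUVNodesN15KingModelFreeRGGaussNorm
import Summits.QuantumFields.YangMills.Theorems.BalabanUVNodesN15KingModelFreeRGForms
import Literature.MathematicalPhysics.QuantumFieldTheory.King1986.ContinuumLimitStatements
import HarnessLib

/-!
# BalabanUVNodes ∕ N15 — THE KING-MODEL RUNG, FREE-FIELD EDITION (PART Τ-e, THE DATUM): KING'S RENORMALIZATION-GROUP DATA `RGData` OF
# [King1986] THEOREMS 3.1 ∕ 3.4 (typer schema `King1986.ContinuumLimit.RGData`) **INHABITED BY THE FREE MASSIVE LATTICE SCALAR FIELD AT `A = 0`,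
# `h = 0`** on the cubic tori `T_{ε_K}`, `ε_K = L^{−K}`: unit-lattice configuration spaces `X m = ℝ^{T₁^{(k)}}` (`M₀L^m` sites per direction when
# `L^kε_K = L^{−m}`), Lebesgue measures `(dφ_k)`, the small-field functions `χ_k` of (3.2) (φ-clause, `λ := 1`), the effective actions
# `S^{(k),1} = ½⟨φ_k, Δ^{(k)}φ_k⟩ − ln N` ((3.14)∕(3.89)–(3.90) at zero coupling) and `Z^{ε_K} ≡ 1` (King's normalisation (2.6))
# (Track A, DAG node N15 = NE2; FAN-OUT v1.1 §N15 s3 «KING-MODEL RUNG»; regen R453 (b))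

HONEST FRAMING.  Count-neutral (cell `pub-ymgap`, seat `pub-ymgap-dag-n15-e` g19; `--supports stmt-QuantumFields-27366 --as helper` = K3⁸
`SpineGivenEndpointR13SepCoPHV`).  TEMPLATE LITERATURE, `A = 0`: the typer's file `King1986/ContinuumLimitStatements` types King's Theorems 3.1 (3.3)–(3.4)
and 3.4 (3.9) as HYPOTHESIS SCHEMAS `RGData.Thm31Printed`, `RGData.Thm34Printed` (with `RGData.UVStable`) over abstract renormalization-group data and
PROVES the deduction (3.10)–(3.13) `⇒ HasContinuumLimit Z` (`RGData.hasContinuumLimit_of_thm31_thm34`); its header records that T3*/N23* cite Thm 3.4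
as their template 26 times and that no inhabitant existed.  THIS FILE is the datum half of PART Τ: it FILLS the schema's fields with the GENUINE objects
of the simplest model King's machine runs on — the free massive one-component scalar field (King's (2.4)–(2.6) with the gauge field, `λ`, the counterterms
and the sources switched off) — and proves nothing yet (parts Τ-f∕Τ-g∕Τ-h prove `Thm34Printed`, `Thm31Printed`, `UVStable` and fire the deduction).
THE FIELDS, and why they are King's: `X m := ℝ^{Π_μ ℤ∕(M₀L^m)}` — the unit-lattice fields `φ_k` on `T₁^{(k)}` for every `(K, k)` with `K − k = m`
(the schema's INDEXING NOTE; `|T₁^{(k)}| = (L^kε_K)^{−d}|T| = L^{md}M₀^d`); `μ m := (dφ_k)` = Lebesgue (`volume` on the Pi type); `chi m` := the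
φ-CLAUSE of (3.2) *"|φ_k(y)| ≤ p(L^{k−1}ε)[λ(L^{k−1}ε)^{4−d}]^{−1∕4}"* read at `λ := 1` (`L^{k−1}ε_K = ε_{m+1}`), i.e. `χ = 1` iff `∀ y, |φ(y)| ≤
p(ε_{m+1})·ε_{m+1}^{−(4−d)∕4}`; `S m k` := `½⟨φ, Δ^{(k)}φ⟩ + ln 𝒩(Δ^{(k)})` with `Δ^{(k)} = kingEffLap L (cube) a (m²ε_m²) k` = King's (2.14)∕(3.15)
effective Laplacian in unit-lattice variables (part Τ-d) for `k ≥ 1` and the bare `−Δ¹ + m²ε_m²` for `k = 0`, and `ln 𝒩(Δ) = ln ∫e^{−½⟨φ,Δφ⟩}dφ` (part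
Τ-a) — this is (3.14) `S^{(k),1} = ½⟨φ_k, Δ^{(k)}φ_k⟩ − ln Z_k(0)… + E₀ + P^{(k),1}` at ZERO COUPLING (`P ≡ 0`, no vector field), where by (3.89)–(3.90) the
surviving constant is King's Gaussian normalisation `ln N_k`, FIXED BY `∫ e^{−S^{(k),1}} dφ_k = Z^{ε_K} = 1` (King's (2.6) normalises the free Gaussian
measure to mass one and the block-spin transformation (2.15) preserves mass); `Z K := 1` accordingly; `vol := M₀^d = |T|` (the torus (2.21) with all
`2L_μ = M₀`, `ε_0 = 1`), `b₀, p` the letters of `p(ε)` (3.1), `L` the block size.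
HONEST SCOPE ∕ WHAT IS NOT CLAIMED.  (i) `S m k` is given in the CLOSED Gaussian form that King's §3.6 derives, not re-derived here from the `k`-fold
integral (2.4)–(2.6)∕(2.13)–(2.15): the quadratic part IS the block-spin minimum by the tree's `King1986.Torus.effLaplacian_eq_energy` ((2.14) = completing
the square) and the constant IS the mass-one normalisation; the Fubini∕composition-law bookkeeping `T_{a,L}^k = T_{a_k,L^k}` at the level of integrals is
NOT formalised (declared; part Τ-i if landed removes it).  (ii) The φ-clause of (3.2) only: at `A = 0` the vector-field clauses are absent and the covariant-
derivative clause *"|D_{A_k}φ_k(b)| ≤ p(L^{k−1}ε)"* (= a gradient clause at `A = 0`) is OMITTED — (3.3) is insensitive to it, (3.4) only gets easier with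
fewer large-field configurations, and (3.9) for the free field needs the φ-clause alone (parts Τ-f∕Τ-g say so again).  (iii) `λ := 1` in the threshold:
the free field has no quartic coupling; King's exponent `(4−d)∕4` is kept literally, so the datum is King-shaped for `d = 1, 2, 3` (parts Τ-g needs
`d ≤ 3`; King's theorem is `d = 2, 3`).  (iv) cubic torus, `h = g = 0`: with sources off, `Z^{ε_K}(T, 0, 0) ≡ 1` and the limit (2.22) is TRIVIAL — the
content of PART Τ is that King's three printed HYPOTHESES hold by name for these genuine objects, i.e. the schema chain is inhabited NON-VACUOUSLY, and that
the deduction runs; nothing about a limit that was in doubt.  NOT Bałaban's objects; NOT a node discharge; nothing continuum-YM ∕ ℝ⁴ ∕ OS ∕ mass-gap ∕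
Clay.  0 `sorry`; FIVE definitions (the datum and its four field objects) + reading lemmas (`rfl`); standard axioms.
Locators: [King1986] (2.4)–(2.6) p.652, (2.13)–(2.15) p.653, (2.21)–(2.22) p.654, (3.1)–(3.2) p.655, Thm 3.1 (3.3)–(3.4) p.655, Thm 3.4 (3.9) p.656,
(3.14)–(3.15) p.657, (3.89)–(3.90) pp.668–669.
-/

noncomputable section

namespace Summit.QuantumFields.YangMills.BalabanUVNodes.N15KingModelRung.FreeField

open Real Finset Matrix MeasureTheory
open Literature.MathematicalPhysics.QuantumFieldTheory.Balaban1983to89 (B2.pFn)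
open Literature.MathematicalPhysics.QuantumFieldTheory.Balaban1983to89.B5Prop11Plancherel (Tor)
open Literature.MathematicalPhysics.QuantumFieldTheory.King1986.Torus (lapF)
open Literature.MathematicalPhysics.QuantumFieldTheory.King1986.ContinuumLimit (eps RGData)

variable {d : ℕ}

/-! ## §1 The carriers: the cubic unit tori `T₁^{(k)}`, `M₀L^m` sites per direction (`L^kε_K = L^{−m}`) -/

/-- **The cubic unit lattice of King's run at depth `m`**: `Π_{μ<d} ℤ∕(M₀L^m)` — `T₁^{(k)}` for every `(K, k)` with `K − k = m` (the torus (2.21) with all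
`2L_μ = M₀`, spacing `L^kε_K = L^{−m}` rescaled to `1`). [cite: King1986, (2.21) p.654, p.656] -/
abbrev cubeSide (M₀ L m : ℕ) : Fin d → ℕ := fun _ => M₀ * L ^ m

/-- The side is non-zero. [folklore] -/
instance cubeSide_neZero (M₀ L m : ℕ) [NeZero M₀] [NeZero L] (μ : Fin d) : NeZero (cubeSide (d := d) M₀ L m μ) :=
  ⟨mul_ne_zero (NeZero.ne M₀) (pow_ne_zero m (NeZero.ne L))⟩

/-- **The unit-lattice mass²** `m²(L^kε_K)² = m²·ε_m²` (King's mass term after rescaling to `T₁^{(k)}`, (3.21) ∕ (4.4)). [cite: King1986, (4.4) p.670] -/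
abbrev unitMassSq (msq : ℝ) (L m : ℕ) : ℝ := msq * eps L m ^ 2

/-! ## §2 The effective quadratic forms `Δ^{(k)}` (and the bare action at `k = 0`) and the effective actions `S^{(k),1}` -/

/-- **King's effective operator at step `k` of the run at depth `m`**: `k = 0` ↦ the bare action's `−Δ¹ + m²ε_m²` on `T_{ε_m}` (= `T₁^{(0)}`);
`k ≥ 1` ↦ `Δ^{(k)} = a_k − a_k²Q_kG_kQ_k^*` at unit-lattice mass `m²ε_m²` (part Τ-d `kingEffLap`). [cite: King1986, (2.4) p.652, (2.14) p.653, (3.15) p.657] -/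
def kingFreeOp (L : ℕ) [NeZero L] (M₀ : ℕ) [NeZero M₀] (a msq : ℝ) (m : ℕ) :
    ℕ → Matrix (Tor (cubeSide (d := d) M₀ L m)) (Tor (cubeSide (d := d) M₀ L m)) ℝ
  | 0 => lapF (cubeSide (d := d) M₀ L m) 1 (unitMassSq msq L m)
  | k + 1 => kingEffLap L (cubeSide (d := d) M₀ L m) a (unitMassSq msq L m) (k + 1)

/-- **THE FREE FIELD's EFFECTIVE ACTION** `S^{(k),1}(T₁^{(k)}, φ_k) = ½⟨φ_k, Δ^{(k)}φ_k⟩ + ln 𝒩(Δ^{(k)})`, `𝒩(Δ) = ∫e^{−½⟨φ,Δφ⟩}dφ` — (3.14) at zero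
coupling with King's normalisation ((2.6), (3.89)–(3.90): the density `e^{−S^{(k),1}}` has mass `Z^{ε_K} = 1`). [cite: King1986, (3.14) p.657, (3.89)–(3.90) pp.668–669] -/
def kingFreeS (L : ℕ) [NeZero L] (M₀ : ℕ) [NeZero M₀] (a msq : ℝ) (m k : ℕ) (φ : Tor (cubeSide (d := d) M₀ L m) → ℝ) : ℝ :=
  (1 / 2 : ℝ) * (φ ⬝ᵥ (kingFreeOp L M₀ a msq m k *ᵥ φ)) + Real.log (gaussNorm (kingFreeOp (d := d) L M₀ a msq m k))

/-! ## §3 The small-field function `χ_k` of (3.2), φ-clause, `λ := 1` -/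

/-- **The small-field threshold** `p(L^{k−1}ε_K)·[λ(L^{k−1}ε_K)^{4−d}]^{−1∕4}` at `λ = 1`, `L^{k−1}ε_K = ε_{m+1}`: `p(ε_{m+1})·ε_{m+1}^{−(4−d)∕4}`,
`p(ε) = b₀(1 + ln ε⁻¹)^p` (3.1) = tree `B2.pFn`. [cite: King1986, (3.1)–(3.2) p.655] -/
def kingFreeThreshold (d : ℕ) (b₀ p : ℝ) (L m : ℕ) : ℝ :=
  B2.pFn b₀ p (eps L (m + 1)) * eps L (m + 1) ^ (-((4 - (d : ℝ)) / 4))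

open Classical in
/-- **`χ_k(φ_k)`** — *"the function which is one when all the following inequalities hold and zero otherwise"* (3.2), here the φ-clause
`|φ_k(y)| ≤ p(ε_{m+1})ε_{m+1}^{−(4−d)∕4}` for all sites `y` (vector-field and covariant-derivative clauses absent ∕ omitted at `A = 0`, see header (ii)).
[cite: King1986, (3.2) p.655] -/
def kingFreeChi (L : ℕ) [NeZero L] (M₀ : ℕ) [NeZero M₀] (b₀ p : ℝ) (m : ℕ) (φ : Tor (cubeSide (d := d) M₀ L m) → ℝ) : ℝ :=
  if ∀ y, |φ y| ≤ kingFreeThreshold d b₀ p L m then 1 else 0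

/-! ## §4 ★ THE DATUM -/

/-- ★ **KING'S RENORMALIZATION-GROUP DATA FOR THE FREE MASSIVE LATTICE SCALAR FIELD** (`A = 0`, `h = g = 0`, cubic torus `|T| = M₀^d`, block size `L`,
Gaussian constant `a`, mass² `msq`, small-field letters `b₀, p`): the schema `ContinuumLimit.RGData` with `X m = ℝ^{T₁^{(k)}}`, `μ = (dφ_k)` Lebesgue,
`χ` = (3.2)'s φ-clause, `S m k = S^{(k),1}` the Gaussian effective action, `Z ≡ 1`. [cite: King1986, Thm 3.1 p.655, Thm 3.4 p.656, (3.14) p.657] -/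
def kingFreeRG (L : ℕ) [NeZero L] (M₀ : ℕ) [NeZero M₀] (a msq b₀ p : ℝ) : RGData (fun m => Tor (cubeSide (d := d) M₀ L m) → ℝ) where
  L := L
  vol := (M₀ : ℝ) ^ d
  b₀ := b₀
  p := p
  μ := fun _ => volume
  chi := fun m φ => kingFreeChi L M₀ b₀ p m φ
  S := fun m k φ => kingFreeS L M₀ a msq m k φ
  Z := fun _ => 1

/-! ## §5 Reading lemmas (all `rfl`) -/

section Readers

variable (L : ℕ) [NeZero L] (M₀ : ℕ) [NeZero M₀] (a msq b₀ p : ℝ)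

/-- `D.L = L`. [folklore] -/
@[simp] theorem kingFreeRG_L : (kingFreeRG (d := d) L M₀ a msq b₀ p).L = L := rfl
/-- `D.vol = M₀^d`. [folklore] -/
@[simp] theorem kingFreeRG_vol : (kingFreeRG (d := d) L M₀ a msq b₀ p).vol = (M₀ : ℝ) ^ d := rfl
/-- `D.b₀ = b₀`. [folklore] -/
@[simp] theorem kingFreeRG_b₀ : (kingFreeRG (d := d) L M₀ a msq b₀ p).b₀ = b₀ := rfl
/-- `D.p = p`. [folklore] -/
@[simp] theorem kingFreeRG_p : (kingFreeRG (d := d) L M₀ a msq b₀ p).p = p := rfl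
/-- `D.μ m = (dφ_k)`, Lebesgue. [folklore] -/
@[simp] theorem kingFreeRG_μ (m : ℕ) : (kingFreeRG (d := d) L M₀ a msq b₀ p).μ m = volume := rfl
/-- `D.chi m = χ`. [folklore] -/
@[simp] theorem kingFreeRG_chi (m : ℕ) (φ : Tor (cubeSide (d := d) M₀ L m) → ℝ) :
    (kingFreeRG (d := d) L M₀ a msq b₀ p).chi m φ = kingFreeChi L M₀ b₀ p m φ := rfl
/-- `D.S m k = S^{(k),1}`. [folklore] -/
@[simp] theorem kingFreeRG_S (m k : ℕ) (φ : Tor (cubeSide (d := d) M₀ L m) → ℝ) :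
    (kingFreeRG (d := d) L M₀ a msq b₀ p).S m k φ = kingFreeS L M₀ a msq m k φ := rfl
/-- `D.Z K = 1`. [cite: King1986, (2.6) p.652] -/
@[simp] theorem kingFreeRG_Z (K : ℕ) : (kingFreeRG (d := d) L M₀ a msq b₀ p).Z K = 1 := rfl

/-- `χ ∈ {0, 1}` — *"one when all the following inequalities hold and zero otherwise"*. [cite: King1986, (3.2) p.655] -/
theorem kingFreeChi_zero_or_one (m : ℕ) (φ : Tor (cubeSide (d := d) M₀ L m) → ℝ) :
    kingFreeChi L M₀ b₀ p m φ = 0 ∨ kingFreeChi L M₀ b₀ p m φ = 1 := by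
  unfold kingFreeChi
  split_ifs
  · exact Or.inr rfl
  · exact Or.inl rfl

/-- `χ = 1` exactly on the small-field set. [cite: King1986, (3.2) p.655] -/
theorem kingFreeChi_eq_one_iff (m : ℕ) (φ : Tor (cubeSide (d := d) M₀ L m) → ℝ) :
    kingFreeChi L M₀ b₀ p m φ = 1 ↔ ∀ y, |φ y| ≤ kingFreeThreshold d b₀ p L m := by
  unfold kingFreeChi
  split_ifs with h
  · simp [h]
  · simp [h]

/-- `0 ≤ χ ≤ 1`. [folklore] -/
theorem kingFreeChi_nonneg_le_one (m : ℕ) (φ : Tor (cubeSide (d := d) M₀ L m) → ℝ) :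
    0 ≤ kingFreeChi L M₀ b₀ p m φ ∧ kingFreeChi L M₀ b₀ p m φ ≤ 1 := by
  rcases kingFreeChi_zero_or_one L M₀ b₀ p m φ with h | h <;> rw [h] <;> norm_num

/-- `S m 0` is the bare action `½⟨φ,(−Δ¹ + m²ε_m²)φ⟩ + ln 𝒩`. [cite: King1986, (2.4)–(2.6) p.652] -/
theorem kingFreeOp_zero (m : ℕ) : kingFreeOp (d := d) L M₀ a msq m 0 = lapF (cubeSide (d := d) M₀ L m) 1 (unitMassSq msq L m) := rfl

/-- `S m k`, `k ≥ 1`, is built on King's `Δ^{(k)}`. [cite: King1986, (2.14) p.653, (3.15) p.657] -/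
theorem kingFreeOp_succ (m k : ℕ) :
    kingFreeOp (d := d) L M₀ a msq m (k + 1) = kingEffLap L (cubeSide (d := d) M₀ L m) a (unitMassSq msq L m) (k + 1) := rfl

/-- The same, for any `k ≥ 1` given as such. [folklore] -/
theorem kingFreeOp_of_pos (m : ℕ) {k : ℕ} (hk : 1 ≤ k) :
    kingFreeOp (d := d) L M₀ a msq m k = kingEffLap L (cubeSide (d := d) M₀ L m) a (unitMassSq msq L m) k := by
  obtain ⟨j, rfl⟩ := Nat.exists_eq_add_of_le' hk
  rfl

/-- The number of unit-lattice sites: `|T₁^{(k)}| = (M₀L^m)^d`. [cite: King1986, (2.15) p.653] -/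
theorem card_cube (m : ℕ) : Fintype.card (Tor (cubeSide (d := d) M₀ L m)) = (M₀ * L ^ m) ^ d := by
  simp [Tor, cubeSide, ZMod.card]

/-- … as a real number, `= |T|·ε_m^{−d}` with `|T| = M₀^d`, `ε_m = L^{−m}`. [cite: King1986, p.669 («(L^kε)^{−d}|T|»)] -/
theorem card_cube_real (m : ℕ) :
    (Fintype.card (Tor (cubeSide (d := d) M₀ L m)) : ℝ) = (M₀ : ℝ) ^ d * (eps L m)⁻¹ ^ d := by
  rw [card_cube]
  unfold eps
  push_cast
  rw [inv_inv, mul_pow]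

end Readers

end Summit.QuantumFields.YangMills.BalabanUVNodes.N15KingModelRung.FreeField

end
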